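import Summits.BirchSwinnertonDyer.BirchSwinnertonDyer.Theorems.EisensteinPrimesBSDpOnCellCTwistCertificate
import Summits.BirchSwinnertonDyer.BirchSwinnertonDyer.Theorems.EisensteinPrimesMazurMCOnX1RankZeroSecondDescentAlgebra
import Literature.NumberTheory.EllipticCurves.Rank1Residual.Typed.CasselsLowerBound
import Literature.NumberTheory.EllipticCurves.Rank1Residual.Typed.HigherDescentCertificate
import HarnessLib

/-!
# Crux 4 `BSDpOnCellC` (stmt-BirchSwinnertonDyer-19034), line b1 v9: the per-pair TWIST–DESCENT-CERTIFICATE road —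
# the twist partner of an X2c pair CLOSED BY A FINITE DESCENT on the rank-zero twist (Cassels–Tate layers / any-level
# stabilisation) instead of the unit bit `p ∤ #Ш(E^{(d_K)})_an` (cell `bsd-eis`, seat `bsd-eis-k5-p4` g0, lens
# «Cassels–Tate / isogeny-descent decision road»; THEOREMS ONLY — nothing booked, no label or count moves)

HONEST FRAMING (cell `bsd-eis`, run/shared/lean/pub/bsd-eis/; ladder row B11 = X2c = `CellC`: `p` odd, `p ‖ N`,
`E[p]` reducible, `r_an = 1`; crux 4 `BSDpOnCellC` stays OPEN; BSD is not proved for any curve by this file). Every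
theorem is CONDITIONAL on its displayed binders: published named facts, the value atom `h2` and the re-oriented IMC
atoms `h3n` / `h3s` of the b1 composition (in §2 discharged exactly as the sibling file does: REFEREED Liu–Zhang–Zhang
+ Keller–Yin 2024 Thm. D BY NAME — an UNREFEREED PREPRINT), and PER PAIR an admissible field `K` plus a FINITE
certificate read on the globally minimal model `Wd` of the rank-zero twist `E^{(d_K)}`.

## What this file adds to `…TwistCertificate.lean` (cgshw g15, §1 `bsdp_of_cellC_of_twistPartnerBSDp`)

The sibling's §2/§3 close the partner `BSDp Wd p` by Wuthrich 2014 Prop. 21 ALONE, which needs the numeric bit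
`p ∤ #Ш(Wd)_an` (`hunit`); its census therefore sorts the ψ-odd B11 cells into CERT / NOUNIT (an admissible `K` in
range, none with the unit bit) / NOADM. On the descent road the unit bit is not needed: `Wd` is an X2 RANK-ZERO pair
(`X2.classX2_twist`: `p` splits in `K`, so `p` stays multiplicative and `E^{(d)}[p]` reducible; `L(Wd,1) ≠ 0`), hence
Wuthrich's UPPER half `ord_p #Ш(Wd) ≤ ord_p #Ш(Wd)_an` holds unconditionally and the LOWER half is a finite
certificate — Cassels–Tate squareness plus `p^{2k-1} ∣ #Ш(Wd)` when `ord_p #Ш(Wd)_an ≤ 2k`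
(`Typed.bsdp_of_wuthrich_of_casselsTate_of_pow_dvd`, the A3/A10 certificate currency `T-WU14-CT-ISODESC`): `k = 0` IS
the unit case, `k = 1` one non-zero element of `Ш(Wd)[p]` (a `φ̂`-descent with `Sel^{φ̂} ⊋ δ(E'(ℚ))`), `k = 2` the
second layer `Ш(Wd)[p] ≠ 0 ∧ Ш(Wd)[p] ⊆ pШ(Wd)` (the Cassels–Tate pairing on `S^{(φ̂)}` vanishes — van Beek–Fisher
2018's cubic-norm-equation algorithm at `p = 3`), and at ANY predicted exponent the native higher-descent certificate
`Ш(Wd)[p^{k+1}] = Ш(Wd)[p^k]`, `#Ш(Wd)[p^k] = p^m`, `ord_p #Ш(Wd)_an = m` (`Typed.bsdp_of_stable`, Gross–Zagier–Kolyvagin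
only — no Wuthrich, no pairing named). So EVERY admissible `K` carries a finite certificate, unit or not: a NOUNIT
cell is «descent not yet run», never «no road», and the road DECIDES the partner either way (if the descent on `Wd`
disagreed with `ord_p #Ш(Wd)_an`, `BSD(Wd,p)` would be false — see the seat's decision file).

* §1 `bsdp_of_cellC_of_twistCasselsTate_pow_dvd` — `K` supplied, partner closed by Wuthrich + Cassels–Tate +
  `p^{2k-1} ∣ #Ш(Wd)`; the shapes `…_of_twistShaTorsion` (`k = 1`), `…_of_twistSecondDescent` (`k = 2`);
  `bsdp_of_cellC_of_twistStable` — partner closed by the any-level stabilisation certificate (GZK only).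
* §2 census shape: v9's published bundle VERBATIM + Wuthrich Prop. 21 + Cassels–Tate bsd.S18 + the REFEREED
  Liu–Zhang–Zhang fact + Keller–Yin Thm. D [PRE] + (pair, `K`, `Wd`, certificate) ⊢ `BSDp W p`.

What this is NOT (the `model=iso` variant — certificate on a curve isogenous to the twist — is a sibling part 2): not a class-wide theorem (crux 3 / Thm. D stay the class-wide inputs on the ψ-odd rows); not a
count move; not preprint-free (the IMC atom is Keller–Yin Thm. D exactly as on the TWC road); the certificates are
instrument READS (two engines per bit is the planner's discipline), nothing is evaluated here.

References: [Wuthrich2014] Prop. 21 (p. 400); [Cassels1962ArithmeticIV]; [SilvermanAEC2009] Thm. X.4.14; [MilneADT2006]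
Thm. I.6.13, I.7.3; [Miller2011LMS] Def. 1.1; van Beek–Fisher, Acta Arith. 185 (2018) 367–396 (the instrument at
`p = 3`); Schaefer–Stoll, Trans. AMS 356 (2004); [CastellaEtAl2021] Thm. 5.3.1; [Hsieh2014] Thm. 1; [KellerYin2024]
Thm. D (PRE); [LiuZhangZhang2018] Thm. 1.5.1/1.5.3; sibling `…TwistCertificate.lean` (cgshw MEMO-19), RULING L62.
-/

set_option autoImplicit false
set_option linter.dupNamespace false

noncomputable section

open scoped Classical MatrixGroups ModularForm Topology

open Filter CongruenceSubgroup WeierstrassCurve NumberField IsDedekindDomain Field PowerSeries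
  Literature.NumberTheory.EllipticCurves Literature.NumberTheory.EllipticCurves.GreenbergSelmer
  Literature.NumberTheory.EllipticCurves.ModularForms Literature.NumberTheory.QuadraticFields
  Literature.NumberTheory.EllipticCurves.Rank1Residual
  Literature.NumberTheory.EllipticCurves.Rank1Residual.Typed
  Literature.NumberTheory.EllipticCurves.KrizLi2019
  Literature.NumberTheory.EllipticCurves.GreenbergVatsal2000
  Literature.NumberTheory.EllipticCurves.Wuthrich2014
  Literature.NumberTheory.EllipticCurves.SteinWuthrich2013
  Literature.NumberTheory.EllipticCurves.Castella2018
  Literature.NumberTheory.EllipticCurves.Castella2018Exceptional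
  Literature.NumberTheory.GaloisRepresentations Literature.NumberTheory.GaloisCohomology
  Literature.NumberTheory.Automorphic
  Summit.BirchSwinnertonDyer.Rank1Residual.X11b.AcSelmer
  Summit.BirchSwinnertonDyer.Rank1Residual.X11b.Halves
  Summit.BirchSwinnertonDyer.Rank1Residual.X11b
  Summit.BirchSwinnertonDyer.Rank1Residual.X2
  Summit.BirchSwinnertonDyer.Rank1Residual
  Summit.BirchSwinnertonDyer.BirchSwinnertonDyer.Theorems.Reoriented
  Summit.BirchSwinnertonDyer.BirchSwinnertonDyer.Theorems.EisensteinPrimesMazurMCOnX1RankZeroSecondDescentAlgebra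

namespace Summit.BirchSwinnertonDyer.BirchSwinnertonDyer.Theorems.TwistDescentCertificate

/-! ### §1 The doors: `K` supplied, partner closed by a finite descent certificate on the twist -/

section Door

variable (W : WeierstrassCurve ℚ) [W.IsElliptic] [W.IsGloballyMinimal] (p : ℕ) [Fact p.Prime]

/-- **TWIST–DESCENT DOOR (either sign at `p`, either ψ-parity), general layer `k`:** `BSD(E,p)` at an X2c pair from
the b1 atoms (`h2`, `h3n`, `h3s`), the published facts of the sibling's §1, Wuthrich 2014 Prop. 21 (`hW21`), the
Cassels–Tate pairing (`hCT`, bsd.S18), ONE admissible `K`, a globally minimal model `Wd` of `E^{(d_K)}`, and the finite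
certificate `#Ш(Wd)_an = q ∈ ℚ`, `ord_p q ≤ 2k`, `p^{2k-1} ∣ #Ш(Wd)` (READ). The partner `BSDp Wd p` is
`Typed.bsdp_of_wuthrich_of_casselsTate_of_pow_dvd` (`Wd` is X2 at `p` by `X2.classX2_twist`, `L(Wd,1) ≠ 0` from `hLK`);
then the sibling's `bsdp_of_cellC_of_twistPartnerBSDp`. `k = 0` is the unit-bit road of the sibling's §2.
CONDITIONAL on every listed binder; nothing booked. [cite: Wuthrich2014, Prop. 21 (p. 400)]
[cite: SilvermanAEC2009, Thm. X.4.14] [cite: CastellaEtAl2021, Thm. 5.3.1 and (5.5)–(5.7)]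
[cite: Hsieh2014, Thm. 1 (arXiv:1112.1580 pp. 3–4)] [claim: KellerYin2024, status: under-review] [cite: Miller2011LMS, Def. 1.1] -/
theorem bsdp_of_cellC_of_twistCasselsTate_pow_dvd (hW21 : sha_dvd_analyticSha)
    (hCT : exists_casselsTate_pairing (K := ℚ))
    (hnf : exists_isNewformOf)
    (hPT : ∀ (K : Type) [Field K] [NumberField K], poitouTate_selmerStructure_duality K)
    (hPT2 : ∀ (K : Type) [Field K] [NumberField K], poitouTate_sha_tateDual K)
    (hH : hsieh2014_exists_anticyclotomicPAdicLFunction)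
    (hGZ : ∀ (N : ℕ) [NeZero N] (W : WeierstrassCurve ℚ) (K : Type) [Field K] [NumberField K],
      gross_zagier N W K)
    (hKo : ∀ (N : ℕ) [NeZero N] (W : WeierstrassCurve ℚ) (K : Type) [Field K] [NumberField K],
      kolyvagin N W K)
    (hGZK : rank_eq_analyticRank_of_analyticRank_le_one)
    (hMaz : mazur_not_dvd_maninConstant_of_odd) (hCassels : bsdRHS_eq_of_isIsogenous)
    (h2 : ∀ (W' : WeierstrassCurve ℚ) [W'.IsElliptic] [W'.IsGloballyMinimal],
      CellC W' p → BDPValueContinuousDisplayAt W' p)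
    (h3n : ∀ (W' : WeierstrassCurve ℚ) [W'.IsElliptic] [W'.IsGloballyMinimal],
      CellC W' p → ¬ W'.HasSplitMultiplicativeReductionAtPrime p → NonsplitIMCEqOnTreeIntOther W' p)
    (h3s : ∀ (W' : WeierstrassCurve ℚ) [W'.IsElliptic] [W'.IsGloballyMinimal],
      CellC W' p → W'.HasSplitMultiplicativeReductionAtPrime p → SplitIMCEqOnTreeIntOther W' p)
    (hc : CellC W p)
    (K : Type) [Field K] [NumberField K] (hK : IsImaginaryQuadratic K)
    (hodd : Odd (NumberField.discr K)) (hlt : NumberField.discr K < -4)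
    (hHN : SatisfiesHeegnerHypothesis (W.conductorNorm ℤ) K) (hHp : SatisfiesHeegnerHypothesis p K)
    (hLK : (W.quadraticTwist (NumberField.discr K : ℚ)).entireLFunction 1 ≠ 0)
    (Wd : WeierstrassCurve ℚ) [Wd.IsElliptic] [Wd.IsGloballyMinimal]
    (hWd : ∃ C : VariableChange ℚ, C • Wd = W.quadraticTwist (NumberField.discr K : ℚ))
    {q : ℚ} (hq : shaAn Wd = (q : ℂ)) {k : ℕ} (hv : padicValRat p q ≤ 2 * k)
    (hdvd : p ^ (2 * k - 1) ∣ Wd.shaOrder) : BSDp W p := by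
  have hmod : hasEntireLFunction_rat := WeierstrassCurve.hasEntireLFunction_rat_of_exists_isNewformOf hnf
  have hD0 : (NumberField.discr K : ℚ) ≠ 0 := by exact_mod_cast NumberField.discr_ne_zero K
  haveI hEt : (W.quadraticTwist (NumberField.discr K : ℚ)).IsElliptic := W.isElliptic_quadraticTwist hD0
  have hXd : ClassX2 Wd p := classX2_twist W p hc.2 K hK hHp Wd hWd
  obtain ⟨Cd, hCd⟩ := hWd
  have hLd : Wd.entireLFunction 1 ≠ 0 := by
    rw [← entireLFunction_smul Wd Cd, hCd]; exact hLK
  have hrd : Wd.analyticRank = 0 := (Wd.analyticRank_eq_zero_iff_holds (hmod _)).2 hLd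
  have hbsd : BSDp Wd p :=
    bsdp_of_wuthrich_of_casselsTate_of_pow_dvd Wd p hCT hW21 hGZK hmod hXd.1 hrd
      (WeierstrassCurve.HasMultiplicativeReduction.not_hasAdditiveReduction (R := ℤ_[p]) hXd.2.2)
      (Or.inl hXd.2.1) hq hv hdvd
  exact bsdp_of_cellC_of_twistPartnerBSDp W p hnf hPT hPT2 hH hGZ hKo hGZK hMaz hCassels h2 h3n h3s hc K hK
    hodd hlt hHN hHp hLK Wd ⟨Cd, hCd⟩ hbsd

/-- **TWIST–DESCENT DOOR, first layer (`k = 1`):** as `bsdp_of_cellC_of_twistCasselsTate_pow_dvd` with the certificate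
in the shape a `φ̂`-descent on the twist delivers — `ord_p #Ш(Wd)_an ≤ 2` and ONE non-zero element of `Ш(Wd)` killed by
`p` (`Typed.dvd_shaOrder_of_exists_torsion`). Nothing booked. [cite: Wuthrich2014, Prop. 21 (p. 400)]
[cite: SilvermanAEC2009, Thm. X.4.14] [claim: KellerYin2024, status: under-review] [cite: Miller2011LMS, Def. 1.1] -/
theorem bsdp_of_cellC_of_twistShaTorsion (hW21 : sha_dvd_analyticSha)
    (hCT : exists_casselsTate_pairing (K := ℚ))
    (hnf : exists_isNewformOf)
    (hPT : ∀ (K : Type) [Field K] [NumberField K], poitouTate_selmerStructure_duality K)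
    (hPT2 : ∀ (K : Type) [Field K] [NumberField K], poitouTate_sha_tateDual K)
    (hH : hsieh2014_exists_anticyclotomicPAdicLFunction)
    (hGZ : ∀ (N : ℕ) [NeZero N] (W : WeierstrassCurve ℚ) (K : Type) [Field K] [NumberField K],
      gross_zagier N W K)
    (hKo : ∀ (N : ℕ) [NeZero N] (W : WeierstrassCurve ℚ) (K : Type) [Field K] [NumberField K],
      kolyvagin N W K)
    (hGZK : rank_eq_analyticRank_of_analyticRank_le_one)
    (hMaz : mazur_not_dvd_maninConstant_of_odd) (hCassels : bsdRHS_eq_of_isIsogenous)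
    (h2 : ∀ (W' : WeierstrassCurve ℚ) [W'.IsElliptic] [W'.IsGloballyMinimal],
      CellC W' p → BDPValueContinuousDisplayAt W' p)
    (h3n : ∀ (W' : WeierstrassCurve ℚ) [W'.IsElliptic] [W'.IsGloballyMinimal],
      CellC W' p → ¬ W'.HasSplitMultiplicativeReductionAtPrime p → NonsplitIMCEqOnTreeIntOther W' p)
    (h3s : ∀ (W' : WeierstrassCurve ℚ) [W'.IsElliptic] [W'.IsGloballyMinimal],
      CellC W' p → W'.HasSplitMultiplicativeReductionAtPrime p → SplitIMCEqOnTreeIntOther W' p)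
    (hc : CellC W p)
    (K : Type) [Field K] [NumberField K] (hK : IsImaginaryQuadratic K)
    (hodd : Odd (NumberField.discr K)) (hlt : NumberField.discr K < -4)
    (hHN : SatisfiesHeegnerHypothesis (W.conductorNorm ℤ) K) (hHp : SatisfiesHeegnerHypothesis p K)
    (hLK : (W.quadraticTwist (NumberField.discr K : ℚ)).entireLFunction 1 ≠ 0)
    (Wd : WeierstrassCurve ℚ) [Wd.IsElliptic] [Wd.IsGloballyMinimal]
    (hWd : ∃ C : VariableChange ℚ, C • Wd = W.quadraticTwist (NumberField.discr K : ℚ))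
    {q : ℚ} (hq : shaAn Wd = (q : ℂ)) (hv : padicValRat p q ≤ 2)
    (hx : ∃ x : Wd.sha, x ≠ 0 ∧ p • x = 0) : BSDp W p :=
  bsdp_of_cellC_of_twistCasselsTate_pow_dvd W p hW21 hCT hnf hPT hPT2 hH hGZ hKo hGZK hMaz hCassels h2 h3n h3s
    hc K hK hodd hlt hHN hHp hLK Wd hWd hq (k := 1) (by simpa using hv)
    (by simpa using dvd_shaOrder_of_exists_torsion Wd p hx)

/-- **TWIST–DESCENT DOOR, second layer (`k = 2`):** as `bsdp_of_cellC_of_twistCasselsTate_pow_dvd` with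
`ord_p #Ш(Wd)_an ≤ 4` and the second-layer certificate `Ш(Wd)[p] ≠ 0` (`hx`) and `Ш(Wd)[p] ⊆ pШ(Wd)` (`hdiv`: the
Cassels–Tate pairing vanishes on `Ш(Wd)[p]` — at `p = 3` the van Beek–Fisher computation on `S^{(φ̂)}(Wd)`), which
give `p⁴ ∣ #Ш(Wd)` (`pow_four_dvd_shaOrder_of_casselsTate_of_forall_exists_nsmul`, k5-c5's second-descent algebra).
Nothing booked. [cite: Wuthrich2014, Prop. 21 (p. 400)] [cite: SilvermanAEC2009, Thm. X.4.14]
[cite: MilneADT2006, Thm. I.6.13] [claim: KellerYin2024, status: under-review] [cite: Miller2011LMS, Def. 1.1] -/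
theorem bsdp_of_cellC_of_twistSecondDescent (hW21 : sha_dvd_analyticSha)
    (hCT : exists_casselsTate_pairing (K := ℚ))
    (hnf : exists_isNewformOf)
    (hPT : ∀ (K : Type) [Field K] [NumberField K], poitouTate_selmerStructure_duality K)
    (hPT2 : ∀ (K : Type) [Field K] [NumberField K], poitouTate_sha_tateDual K)
    (hH : hsieh2014_exists_anticyclotomicPAdicLFunction)
    (hGZ : ∀ (N : ℕ) [NeZero N] (W : WeierstrassCurve ℚ) (K : Type) [Field K] [NumberField K],
      gross_zagier N W K)
    (hKo : ∀ (N : ℕ) [NeZero N] (W : WeierstrassCurve ℚ) (K : Type) [Field K] [NumberField K],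
      kolyvagin N W K)
    (hGZK : rank_eq_analyticRank_of_analyticRank_le_one)
    (hMaz : mazur_not_dvd_maninConstant_of_odd) (hCassels : bsdRHS_eq_of_isIsogenous)
    (h2 : ∀ (W' : WeierstrassCurve ℚ) [W'.IsElliptic] [W'.IsGloballyMinimal],
      CellC W' p → BDPValueContinuousDisplayAt W' p)
    (h3n : ∀ (W' : WeierstrassCurve ℚ) [W'.IsElliptic] [W'.IsGloballyMinimal],
      CellC W' p → ¬ W'.HasSplitMultiplicativeReductionAtPrime p → NonsplitIMCEqOnTreeIntOther W' p)
    (h3s : ∀ (W' : WeierstrassCurve ℚ) [W'.IsElliptic] [W'.IsGloballyMinimal],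
      CellC W' p → W'.HasSplitMultiplicativeReductionAtPrime p → SplitIMCEqOnTreeIntOther W' p)
    (hc : CellC W p)
    (K : Type) [Field K] [NumberField K] (hK : IsImaginaryQuadratic K)
    (hodd : Odd (NumberField.discr K)) (hlt : NumberField.discr K < -4)
    (hHN : SatisfiesHeegnerHypothesis (W.conductorNorm ℤ) K) (hHp : SatisfiesHeegnerHypothesis p K)
    (hLK : (W.quadraticTwist (NumberField.discr K : ℚ)).entireLFunction 1 ≠ 0)
    (Wd : WeierstrassCurve ℚ) [Wd.IsElliptic] [Wd.IsGloballyMinimal]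
    (hWd : ∃ C : VariableChange ℚ, C • Wd = W.quadraticTwist (NumberField.discr K : ℚ))
    {q : ℚ} (hq : shaAn Wd = (q : ℂ)) (hv : padicValRat p q ≤ 4)
    (hx : ∃ x : Wd.sha, x ≠ 0 ∧ p • x = 0) (hdiv : ∀ x : Wd.sha, p • x = 0 → ∃ y : Wd.sha, p • y = x) :
    BSDp W p := by
  have hmod : hasEntireLFunction_rat := WeierstrassCurve.hasEntireLFunction_rat_of_exists_isNewformOf hnf
  have hD0 : (NumberField.discr K : ℚ) ≠ 0 := by exact_mod_cast NumberField.discr_ne_zero K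
  haveI hEt : (W.quadraticTwist (NumberField.discr K : ℚ)).IsElliptic := W.isElliptic_quadraticTwist hD0
  obtain ⟨Cd, hCd⟩ := hWd
  have hLd : Wd.entireLFunction 1 ≠ 0 := by
    rw [← entireLFunction_smul Wd Cd, hCd]; exact hLK
  have hrd : Wd.analyticRank = 0 := (Wd.analyticRank_eq_zero_iff_holds (hmod _)).2 hLd
  have h4 : p ^ 4 ∣ Wd.shaOrder :=
    pow_four_dvd_shaOrder_of_casselsTate_of_forall_exists_nsmul Wd p hCT (hGZK Wd (by omega)).2 hx hdiv
  exact bsdp_of_cellC_of_twistCasselsTate_pow_dvd W p hW21 hCT hnf hPT hPT2 hH hGZ hKo hGZK hMaz hCassels h2 h3n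
    h3s hc K hK hodd hlt hHN hHp hLK Wd ⟨Cd, hCd⟩ hq (k := 2) (by simpa using hv)
    ((pow_dvd_pow p (by norm_num)).trans h4)

/-- **TWIST–STABILISATION DOOR (any predicted exponent; no Wuthrich, no pairing named):** as the sibling's §1 with the
partner `BSDp Wd p` closed by the NATIVE higher-descent certificate on the twist — `Ш(Wd)[p^{k+1}] = Ш(Wd)[p^k]`
(`hstab`), `#Ш(Wd)[p^k] = p^m` (`hcard`), `#Ш(Wd)_an = q` with `ord_p q = m` (`Typed.bsdp_of_stable`, Gross–Zagier–Kolyvagin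
only: `r_an(Wd) = 0` from `hLK`). Nothing booked. [cite: SilvermanAEC2009, Thm. X.4.2] [cite: Miller2011LMS, §1 and Def. 1.1]
[cite: CastellaEtAl2021, Thm. 5.3.1] [claim: KellerYin2024, status: under-review] -/
theorem bsdp_of_cellC_of_twistStable
    (hnf : exists_isNewformOf)
    (hPT : ∀ (K : Type) [Field K] [NumberField K], poitouTate_selmerStructure_duality K)
    (hPT2 : ∀ (K : Type) [Field K] [NumberField K], poitouTate_sha_tateDual K)
    (hH : hsieh2014_exists_anticyclotomicPAdicLFunction)
    (hGZ : ∀ (N : ℕ) [NeZero N] (W : WeierstrassCurve ℚ) (K : Type) [Field K] [NumberField K],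
      gross_zagier N W K)
    (hKo : ∀ (N : ℕ) [NeZero N] (W : WeierstrassCurve ℚ) (K : Type) [Field K] [NumberField K],
      kolyvagin N W K)
    (hGZK : rank_eq_analyticRank_of_analyticRank_le_one)
    (hMaz : mazur_not_dvd_maninConstant_of_odd) (hCassels : bsdRHS_eq_of_isIsogenous)
    (h2 : ∀ (W' : WeierstrassCurve ℚ) [W'.IsElliptic] [W'.IsGloballyMinimal],
      CellC W' p → BDPValueContinuousDisplayAt W' p)
    (h3n : ∀ (W' : WeierstrassCurve ℚ) [W'.IsElliptic] [W'.IsGloballyMinimal],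
      CellC W' p → ¬ W'.HasSplitMultiplicativeReductionAtPrime p → NonsplitIMCEqOnTreeIntOther W' p)
    (h3s : ∀ (W' : WeierstrassCurve ℚ) [W'.IsElliptic] [W'.IsGloballyMinimal],
      CellC W' p → W'.HasSplitMultiplicativeReductionAtPrime p → SplitIMCEqOnTreeIntOther W' p)
    (hc : CellC W p)
    (K : Type) [Field K] [NumberField K] (hK : IsImaginaryQuadratic K)
    (hodd : Odd (NumberField.discr K)) (hlt : NumberField.discr K < -4)
    (hHN : SatisfiesHeegnerHypothesis (W.conductorNorm ℤ) K) (hHp : SatisfiesHeegnerHypothesis p K)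
    (hLK : (W.quadraticTwist (NumberField.discr K : ℚ)).entireLFunction 1 ≠ 0)
    (Wd : WeierstrassCurve ℚ) [Wd.IsElliptic] [Wd.IsGloballyMinimal]
    (hWd : ∃ C : VariableChange ℚ, C • Wd = W.quadraticTwist (NumberField.discr K : ℚ))
    {k m : ℕ} (hstab : ∀ x : Wd.sha, p ^ (k + 1) • x = 0 → p ^ k • x = 0)
    (hcard : Nat.card (AddSubgroup.torsionBy Wd.sha (p ^ k : ℕ)) = p ^ m)
    {q : ℚ} (hq : shaAn Wd = (q : ℂ)) (hv : padicValRat p q = m) : BSDp W p := by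
  have hmod : hasEntireLFunction_rat := WeierstrassCurve.hasEntireLFunction_rat_of_exists_isNewformOf hnf
  have hD0 : (NumberField.discr K : ℚ) ≠ 0 := by exact_mod_cast NumberField.discr_ne_zero K
  haveI hEt : (W.quadraticTwist (NumberField.discr K : ℚ)).IsElliptic := W.isElliptic_quadraticTwist hD0
  obtain ⟨Cd, hCd⟩ := hWd
  have hLd : Wd.entireLFunction 1 ≠ 0 := by
    rw [← entireLFunction_smul Wd Cd, hCd]; exact hLK
  have hrd : Wd.analyticRank = 0 := (Wd.analyticRank_eq_zero_iff_holds (hmod _)).2 hLd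
  have hbsd : BSDp Wd p := bsdp_of_stable Wd p hGZK (by omega) hstab hcard hq hv
  exact bsdp_of_cellC_of_twistPartnerBSDp W p hnf hPT hPT2 hH hGZ hKo hGZK hMaz hCassels h2 h3n h3s hc K hK
    hodd hlt hHN hHp hLK Wd ⟨Cd, hCd⟩ hbsd

end Door

/-! ### §2 Census shape: v9's published bundle + Wuthrich Prop. 21 + Cassels–Tate + LZZ (refereed) + Keller–Yin Thm. D -/

section Census

/-- **PER-PAIR TWIST–DESCENT ROAD, FACT LEVEL (census shape):** v9's `stub_publishedFacts` bundle VERBATIM (`hPub`),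
Wuthrich 2014 Prop. 21 (`hW21`), the Cassels–Tate pairing bsd.S18 (`hCT`), the REFEREED Liu–Zhang–Zhang fact (`hF`, via
k5-c4's glue `X2.lzzRoadInputIoo_of_thm151_thm153`) and Keller–Yin Thm. D BY NAME (`hD`, PRE): for every X2c pair `(W, p)`
of EITHER ψ-parity, every admissible `K`, every globally minimal model `Wd` of `E^{(d_K)}` and every layer-`k` certificate
`#Ш(Wd)_an = q`, `ord_p q ≤ 2k`, `p^{2k-1} ∣ #Ш(Wd)`, `BSD(E,p)` holds. `k = 0` recovers the sibling's
`bsdp_of_cellC_of_twistShaUnit_of_thm151_thm153_of_thmD_OPEN` (unit bit); `k ≥ 1` is the NOUNIT currency. A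
`conditional-result`; nothing booked. [claim: KellerYin2024, status: under-review]
[cite: KellerYin2024, Thm. D = Thm. 5.1.3 (arXiv:2402.12781v2 L306–L309)]
[cite: LiuZhangZhang2018, Thm. 1.5.1 and Remark 1.1.2 and Thm. 1.5.3 (Duke 167 pp. 745–749)]
[cite: Wuthrich2014, Prop. 21 (p. 400)] [cite: SilvermanAEC2009, Thm. X.4.14] [cite: Hsieh2014, Thm. 1 (arXiv:1112.1580 pp. 3–4)]
[cite: CastellaEtAl2021, Thm. 5.3.1] [cite: Mazur1978, Cor. 4.1] [cite: Miller2011LMS, Def. 1.1] -/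
theorem bsdp_of_cellC_of_twistCasselsTate_pow_dvd_of_thm151_thm153_of_thmD_OPEN
    (hPub : (lambdaMu_multiplicative_of_gvPar ∧ thm16_charIdeal_dvd_multiplicative_of_reducible ∧
      thm61_splitMultiplicative ∧ thm61_nonsplitMultiplicative ∧
      (∀ (W : WeierstrassCurve ℚ) [W.IsElliptic] [W.IsGloballyMinimal] (p : ℕ) [Fact p.Prime],
        greenberg_stevens (W := W) (p := p)) ∧
      exists_isNewformOf ∧
      (∀ (K : Type) [Field K] [NumberField K], poitouTate_selmerStructure_duality K) ∧
      (∀ (K : Type) [Field K] [NumberField K], poitouTate_sha_tateDual K) ∧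
      hsieh2014_exists_anticyclotomicPAdicLFunction ∧
      (∀ (N : ℕ) [NeZero N] (W : WeierstrassCurve ℚ) (K : Type) [Field K] [NumberField K],
        gross_zagier N W K) ∧
      (∀ (N : ℕ) [NeZero N] (W : WeierstrassCurve ℚ) (K : Type) [Field K] [NumberField K],
        kolyvagin N W K) ∧
      rank_eq_analyticRank_of_analyticRank_le_one ∧ HoffsteinLuo1997_exists_twist_L_one_ne_zero ∧
      mazur_not_dvd_maninConstant_of_odd ∧ bsdRHS_eq_of_isIsogenous) ∧
      thm210_thm211_bdpDisplay_pNew)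
    (hW21 : sha_dvd_analyticSha) (hCT : exists_casselsTate_pairing (K := ℚ))
    (hF : LiuZhangZhang2018.thm151_thm153_modularCurve_heegnerVector)
    (hD : KellerYin2024.thmD_imcMult_exists_isBDPLFunction_isTorsion_charIdeal_eq_OPEN)
    (W : WeierstrassCurve ℚ) [W.IsElliptic] [W.IsGloballyMinimal] (p : ℕ) [Fact p.Prime] (hc : CellC W p)
    (K : Type) [Field K] [NumberField K] (hK : IsImaginaryQuadratic K)
    (hodd : Odd (NumberField.discr K)) (hlt : NumberField.discr K < -4)
    (hHN : SatisfiesHeegnerHypothesis (W.conductorNorm ℤ) K) (hHp : SatisfiesHeegnerHypothesis p K)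
    (hLK : (W.quadraticTwist (NumberField.discr K : ℚ)).entireLFunction 1 ≠ 0)
    (Wd : WeierstrassCurve ℚ) [Wd.IsElliptic] [Wd.IsGloballyMinimal]
    (hWd : ∃ C : VariableChange ℚ, C • Wd = W.quadraticTwist (NumberField.discr K : ℚ))
    {q : ℚ} (hq : shaAn Wd = (q : ℂ)) {k : ℕ} (hv : padicValRat p q ≤ 2 * k)
    (hdvd : p ^ (2 * k - 1) ∣ Wd.shaOrder) : BSDp W p := by
  obtain ⟨⟨-, -, -, -, -, hnf, hPT, hPT2, hH, hGZ, hKo, hGZK, -, hMaz, hCassels⟩, -⟩ := hPub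
  have hL : X2.LZZRoadInputIoo := X2.lzzRoadInputIoo_of_thm151_thm153 hF
  exact bsdp_of_cellC_of_twistCasselsTate_pow_dvd W p hW21 hCT hnf hPT hPT2 hH hGZ hKo hGZK hMaz hCassels
    (fun W' _ _ _ ↦ X2.bdpValueContinuousDisplayAt_of_lzzRoadInputIoo hL W' p)
    (fun W' _ _ hc' hns ↦ X2.forall_nonsplitIMCEqOnTreeIntOther_of_thmD_OPEN hD W' p hc' hns)
    (fun W' _ _ hc' hs ↦ X2.forall_splitIMCEqOnTreeIntOther_of_thmD_OPEN hD W' p hc' hs)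
    hc K hK hodd hlt hHN hHp hLK Wd hWd hq hv hdvd

/-- **PER-PAIR TWIST–STABILISATION ROAD, FACT LEVEL (census shape):** as the previous theorem with the partner closed by
the native higher-descent certificate on `Wd` (`Ш(Wd)[p^{k+1}] = Ш(Wd)[p^k]`, `#Ш(Wd)[p^k] = p^m`, `ord_p #Ш(Wd)_an = m`);
no Wuthrich and no pairing binder. A `conditional-result`; nothing booked. [claim: KellerYin2024, status: under-review]
[cite: KellerYin2024, Thm. D = Thm. 5.1.3 (arXiv:2402.12781v2 L306–L309)]
[cite: LiuZhangZhang2018, Thm. 1.5.1 and Thm. 1.5.3 (Duke 167 pp. 748–749)] [cite: SilvermanAEC2009, Thm. X.4.2]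
[cite: Hsieh2014, Thm. 1 (arXiv:1112.1580 pp. 3–4)] [cite: CastellaEtAl2021, Thm. 5.3.1] [cite: Mazur1978, Cor. 4.1]
[cite: Miller2011LMS, §1 and Def. 1.1] -/
theorem bsdp_of_cellC_of_twistStable_of_thm151_thm153_of_thmD_OPEN
    (hPub : (lambdaMu_multiplicative_of_gvPar ∧ thm16_charIdeal_dvd_multiplicative_of_reducible ∧
      thm61_splitMultiplicative ∧ thm61_nonsplitMultiplicative ∧
      (∀ (W : WeierstrassCurve ℚ) [W.IsElliptic] [W.IsGloballyMinimal] (p : ℕ) [Fact p.Prime],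
        greenberg_stevens (W := W) (p := p)) ∧
      exists_isNewformOf ∧
      (∀ (K : Type) [Field K] [NumberField K], poitouTate_selmerStructure_duality K) ∧
      (∀ (K : Type) [Field K] [NumberField K], poitouTate_sha_tateDual K) ∧
      hsieh2014_exists_anticyclotomicPAdicLFunction ∧
      (∀ (N : ℕ) [NeZero N] (W : WeierstrassCurve ℚ) (K : Type) [Field K] [NumberField K],
        gross_zagier N W K) ∧
      (∀ (N : ℕ) [NeZero N] (W : WeierstrassCurve ℚ) (K : Type) [Field K] [NumberField K],
        kolyvagin N W K) ∧
      rank_eq_analyticRank_of_analyticRank_le_one ∧ HoffsteinLuo1997_exists_twist_L_one_ne_zero ∧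
      mazur_not_dvd_maninConstant_of_odd ∧ bsdRHS_eq_of_isIsogenous) ∧
      thm210_thm211_bdpDisplay_pNew)
    (hF : LiuZhangZhang2018.thm151_thm153_modularCurve_heegnerVector)
    (hD : KellerYin2024.thmD_imcMult_exists_isBDPLFunction_isTorsion_charIdeal_eq_OPEN)
    (W : WeierstrassCurve ℚ) [W.IsElliptic] [W.IsGloballyMinimal] (p : ℕ) [Fact p.Prime] (hc : CellC W p)
    (K : Type) [Field K] [NumberField K] (hK : IsImaginaryQuadratic K)
    (hodd : Odd (NumberField.discr K)) (hlt : NumberField.discr K < -4)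
    (hHN : SatisfiesHeegnerHypothesis (W.conductorNorm ℤ) K) (hHp : SatisfiesHeegnerHypothesis p K)
    (hLK : (W.quadraticTwist (NumberField.discr K : ℚ)).entireLFunction 1 ≠ 0)
    (Wd : WeierstrassCurve ℚ) [Wd.IsElliptic] [Wd.IsGloballyMinimal]
    (hWd : ∃ C : VariableChange ℚ, C • Wd = W.quadraticTwist (NumberField.discr K : ℚ))
    {k m : ℕ} (hstab : ∀ x : Wd.sha, p ^ (k + 1) • x = 0 → p ^ k • x = 0)
    (hcard : Nat.card (AddSubgroup.torsionBy Wd.sha (p ^ k : ℕ)) = p ^ m)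
    {q : ℚ} (hq : shaAn Wd = (q : ℂ)) (hv : padicValRat p q = m) : BSDp W p := by
  obtain ⟨⟨-, -, -, -, -, hnf, hPT, hPT2, hH, hGZ, hKo, hGZK, -, hMaz, hCassels⟩, -⟩ := hPub
  have hL : X2.LZZRoadInputIoo := X2.lzzRoadInputIoo_of_thm151_thm153 hF
  exact bsdp_of_cellC_of_twistStable W p hnf hPT hPT2 hH hGZ hKo hGZK hMaz hCassels
    (fun W' _ _ _ ↦ X2.bdpValueContinuousDisplayAt_of_lzzRoadInputIoo hL W' p)
    (fun W' _ _ hc' hns ↦ X2.forall_nonsplitIMCEqOnTreeIntOther_of_thmD_OPEN hD W' p hc' hns)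
    (fun W' _ _ hc' hs ↦ X2.forall_splitIMCEqOnTreeIntOther_of_thmD_OPEN hD W' p hc' hs)
    hc K hK hodd hlt hHN hHp hLK Wd hWd hstab hcard hq hv

end Census

end Summit.BirchSwinnertonDyer.BirchSwinnertonDyer.Theorems.TwistDescentCertificate

end
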